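import Mathlib
import Literature.Computability.AlgebraicComplexity.LRPencilOfMatrix

/-!
# `ConfusionCovering` (crux dir `OrbitDimensionBound`, stmt-ValiantsHypothesis-16133, route FreeSubtorus):
# Leibniz extraction — a square-free monomial of the determinant of an AFFINE matrix is carried by one
# permutation and one assignment of its variables to entries

Tool file for the proof of the rung `ConfusionCovering` (line `confusion_covering`, stub `stub_pathWeights`).

If `M` is an `m × m` matrix of polynomials of total degree `≤ 1` and the coefficient of the square-free monomial
`∏_{v ∈ ι} x_v` in `det M` is non-zero, then some permutation `π ∈ 𝔖_m` and some injection `τ : ι ↪ [m]` have: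
the `x_v`-coefficient of the entry `M (π (τ v)) (τ v)` is non-zero for every `v`, and the constant coefficient of
`M (π j) j` is non-zero for every column `j` outside the range of `τ` (`exists_perm_embedding_of_coeff_det_ne_zero`).
Proof: Leibniz expansion, then the expansion of a product of affine polynomials over the choice, in each factor, of the
constant term or of one variable (`exists_assignment_of_coeff_prod_ne_zero`). [folklore]
-/

open Matrix MvPolynomial Finset
open Literature.Computability.AlgebraicComplexity LRPencil

-- the mandated summit-side namespace repeats a component by design (single-problem summit)
set_option linter.dupNamespace false

namespace Summit.ValiantsHypothesis.ValiantsHypothesis.Theorems.FreeSubtorusConfusionCovering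

noncomputable section

variable {R : Type*} [CommRing R] {ι : Type*} [DecidableEq ι] {m : ℕ}

/-- The exponent attached to a choice: `none ↦ 0` (constant term), `some v ↦ e_v` (the variable `x_v`). [folklore] -/
theorem option_elim_single_apply (o : Option ι) (v : ι) :
    (o.elim (0 : ι →₀ ℕ) fun v' => Finsupp.single v' 1) v = if o = some v then 1 else 0 := by
  cases o with
  | none => simp
  | some v' =>
    simp only [Option.elim_some, Finsupp.single_apply, Option.some.injEq]

omit [DecidableEq ι] in
/-- An affine polynomial is the sum, over `none` and the variables, of its monomials of degree `≤ 1`. [folklore] -/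
theorem eq_sum_option_monomial [Fintype ι] (f : MvPolynomial ι R) (hf : f.totalDegree ≤ 1) :
    f = ∑ o : Option ι, monomial (o.elim (0 : ι →₀ ℕ) fun v => Finsupp.single v 1)
      (o.elim (coeff 0 f) fun v => coeff (Finsupp.single v 1) f) := by
  conv_lhs => rw [eq_affine_of_totalDegree_le_one f hf]
  rw [Fintype.sum_option]
  simp only [Option.elim_none, Option.elim_some, C_mul_X_eq_monomial]
  rw [C_apply]

/-- **Expansion of a product of affine polynomials.**  If the coefficient of `∏_v x_v` in `∏_i f_i` (all `f_i` of
total degree `≤ 1`) is non-zero, there is an assignment `F : [m] → Option ι` hitting every variable exactly once,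
with `coeff_0 (f i) ≠ 0` where `F i = none` and `coeff_{x_v} (f i) ≠ 0` where `F i = some v`. [folklore] -/
theorem exists_assignment_of_coeff_prod_ne_zero [Fintype ι] (f : Fin m → MvPolynomial ι R) (hf : ∀ i, (f i).totalDegree ≤ 1)
    (h : coeff (∑ v : ι, Finsupp.single v 1) (∏ i, f i) ≠ 0) :
    ∃ F : Fin m → Option ι,
      (∀ v, ∃! i, F i = some v) ∧
      (∀ i, F i = none → coeff 0 (f i) ≠ 0) ∧
      (∀ i v, F i = some v → coeff (Finsupp.single v 1) (f i) ≠ 0) := by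
  classical
  -- notation
  set e : Option ι → (ι →₀ ℕ) := fun o => o.elim (0 : ι →₀ ℕ) fun v => Finsupp.single v 1 with he
  set a : Fin m → Option ι → R := fun i o => o.elim (coeff 0 (f i)) fun v => coeff (Finsupp.single v 1) (f i)
    with ha
  -- expand the product
  have hprod : ∏ i, f i = ∑ F : Fin m → Option ι, monomial (∑ i, e (F i)) (∏ i, a i (F i)) := by
    have h1 : ∏ i, f i = ∏ i, ∑ o ∈ (univ : Finset (Option ι)), monomial (e o) (a i o) :=
      Finset.prod_congr rfl fun i _ => eq_sum_option_monomial (f i) (hf i)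
    rw [h1, Finset.prod_univ_sum, Fintype.piFinset_univ]
    refine Finset.sum_congr rfl fun F _ => ?_
    have h2 : ∀ i ∈ (univ : Finset (Fin m)), monomial (e (F i)) (a i (F i)) =
        C (a i (F i)) * monomial (e (F i)) (1 : R) := fun i _ => by
      rw [C_mul_monomial, mul_one]
    rw [Finset.prod_congr rfl h2, prod_mul_distrib, ← map_prod, ← monomial_sum_one, C_mul_monomial, mul_one]
  -- extract the coefficient
  rw [hprod, coeff_sum] at h
  obtain ⟨F, -, hF⟩ := Finset.exists_ne_zero_of_sum_ne_zero h
  rw [coeff_monomial] at hF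
  have hdeg : (∑ i, e (F i)) = ∑ v : ι, Finsupp.single v 1 := by
    by_contra hne; rw [if_neg hne] at hF; exact hF rfl
  rw [if_pos hdeg] at hF
  have hfac : ∀ i, a i (F i) ≠ 0 := fun i h0 => hF (Finset.prod_eq_zero (mem_univ i) h0)
  refine ⟨F, fun v => ?_, fun i hi => ?_, fun i v hi => ?_⟩
  · -- every variable is hit exactly once
    have hcount : (univ.filter fun i => F i = some v).card = 1 := by
      have h1 := congrArg (fun d : ι →₀ ℕ => d v) hdeg
      simp only [Finsupp.coe_finsetSum, Finset.sum_apply, he, option_elim_single_apply, Finsupp.single_apply,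
        Finset.sum_ite_eq', mem_univ, if_true] at h1
      rw [Finset.card_filter]
      exact h1
    obtain ⟨i₀, hi₀⟩ := Finset.card_eq_one.1 hcount
    refine ⟨i₀, ?_, fun i hi => ?_⟩
    · have : i₀ ∈ univ.filter fun i => F i = some v := by rw [hi₀]; exact mem_singleton_self _
      exact (mem_filter.1 this).2
    · have : i ∈ univ.filter fun i => F i = some v := mem_filter.2 ⟨mem_univ _, hi⟩
      rw [hi₀] at this
      exact mem_singleton.1 this
  · have := hfac i
    rw [ha, hi] at this
    simpa using this
  · have := hfac i
    rw [ha, hi] at this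
    simpa using this

/-- **Leibniz extraction.**  If the coefficient of the square-free monomial `∏_v x_v` in `det M` is non-zero for an
affine `m × m` matrix `M`, then for some `π ∈ 𝔖_m` and some injection `τ : ι ↪ [m]`: the `x_v`-coefficient of
`M (π (τ v)) (τ v)` is non-zero for all `v`, and the constant coefficient of `M (π j) j` is non-zero for all columns
`j ∉ range τ`. [folklore] -/
theorem exists_perm_embedding_of_coeff_det_ne_zero [Fintype ι] (M : Matrix (Fin m) (Fin m) (MvPolynomial ι R))
    (hM : ∀ i j, (M i j).totalDegree ≤ 1) (h : coeff (∑ v : ι, Finsupp.single v 1) M.det ≠ 0) :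
    ∃ (π : Equiv.Perm (Fin m)) (τ : ι ↪ Fin m),
      (∀ v, coeff (Finsupp.single v 1) (M (π (τ v)) (τ v)) ≠ 0) ∧
      (∀ j, j ∉ Set.range τ → coeff 0 (M (π j) j) ≠ 0) := by
  classical
  -- one permutation carries the monomial
  obtain ⟨π, hπ⟩ : ∃ π : Equiv.Perm (Fin m), coeff (∑ v : ι, Finsupp.single v 1) (∏ i, M (π i) i) ≠ 0 := by
    by_contra hall
    push Not at hall
    apply h
    rw [Matrix.det_apply, coeff_sum]
    refine Finset.sum_eq_zero fun π _ => ?_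
    rw [Units.smul_def, coeff_smul, hall π, smul_zero]
  obtain ⟨F, huniq, hnone, hsome⟩ :=
    exists_assignment_of_coeff_prod_ne_zero (fun i => M (π i) i) (fun i => hM _ _) hπ
  choose τ hτ hτu using huniq
  have hτinj : Function.Injective τ := fun v v' hvv => by
    have h1 := hτ v
    rw [hvv, hτ v'] at h1
    exact (Option.some.inj h1).symm
  refine ⟨π, ⟨τ, hτinj⟩, fun v => hsome _ _ (hτ v), fun j hj => hnone j ?_⟩
  -- a column outside the range of `τ` carries a constant
  cases hFj : F j with
  | none => rfl
  | some v => exact absurd ⟨v, (hτu v j hFj).symm⟩ hj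

end

end Summit.ValiantsHypothesis.ValiantsHypothesis.Theorems.FreeSubtorusConfusionCovering
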